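/-
Origin: expansion seat `planner-pub-hodgecm-pv07-g3-0`, handover #1 2026-08-18T08:35:00Z (`HOME/pub-hodgecm-pv07-g3/lean/Pv07g3/LocTorusSplit.lean`, md5 b9c6bbd5, 496 lines);
landed by the gen-7 packager in gate run 27 as `HodgeCM/PerL34/LocTorusSplit.lean` (import ^import Pv[0-9]+g[0-9]+\.→import HodgeCM.PerL34. ×1).
-/
/-
HodgeCM / PerL34 publication cell — seam S3 set-up, genuine model, SPLIT finite places (pub-hodgecm-pv07-g3, CLAIM #1).
WIP import: `Pv09g4.LocTorusClosed` ↦ `HodgeCM.PerL34.LocTorusClosed` (pv09-g4 HANDOVER #17; brings `IdelicTorusModel`,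
`IdelePlaces`); second import is tree (`HodgeCM.PerL34.LocalFactors.AdicSplitFactor`, r19/r24: `IsUniformizer.ord`, the
`NontriviallyNormedField` structure on `L_w`); everything else reached through them (`NormOneRelTorus`, vendored
`GaloisActionPlaces/AdeleRing`) or Mathlib.  Complete proofs, no new axioms, nothing cited.
-/
import Summits.HodgeConjecture.HodgeCM.PerL34.LocTorusClosed
import Summits.HodgeConjecture.HodgeCM.PerL34.LocalFactors.AdicSplitFactor

/-!
# The local group `locTorus K L v` at a SPLIT finite place: `U_v ≃ₜ* L_wˣ`, level `𝒪_wˣ`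

Per-place item (d2) of GAPS pv09g4-A6/A7/A8 — the split half of what separates pv09-g4's place-indexed model
`torusEquiv K L : U(1)_{L/K}(𝔸_K) ≃ₜ* Πʳ_v [locTorus K L v, (Π_{w∣v} 𝒪_wˣ) ⊓ locTorus v]` (`IdelicTorusModel`)
from statements purely about the quadratic extension `L/K`.  Setting: `Aut(L/K) = {1, σ}` (hypothesis
`h2 : ∀ τ, τ = 1 ∨ τ = σ`; for a CM field `K = L⁺`, `σ = c`: `eq_one_or_eq_complexConj`, from the tree's
`NumberField.univ_eq_pair_complexConj`), `L/K` Galois, `w` a finite place of `L` with `σ • w ≠ w` ("`v = w ∩ K`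
splits in `L`"; `hwv : w.under (𝓞 K) = v`).  Contents (namespace `HodgeCM.PerL34.IdelicTorusModel`):

* §1–§2 idele coordinates: `fc_galSmul : (σ • y)_u = σ_u(y_{σ⁻¹u})` (definitional, vendored
  `FiniteAdeleRing.smul_apply`), `fc_ideleGalNorm : (N y)_u = ∏_σ σ_u(y_{σ⁻¹u})` for pv11-g4's Galois norm
  `N y = ∏_σ σ • y`, and in the quadratic case `fc_ideleGalNorm_of_pair : (N y)_u = y_u · σ(y_{σu})`
  (`σ : L_{σu} →+* L_u` the vendored transport of completions `galAdicCompletionMap`);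
* §3 the integral level `intUnits L (inr u) = 𝒪_uˣ` as `Valued.v = 1` / `‖·‖ = 1`, and `σ 𝒪_uˣ = 𝒪_{σu}ˣ`;
* §4 the fibre of `pl K L` over `v` is `{w, σw}` (`fib_cases`, transitivity of `Aut(L/K)` on the places over
  `v`, vendored `exists_algEquiv_smul_eq`) and **`mem_locTorus_iff_of_split : z ∈ locTorus K L v ↔
  z_{σw} = σ(z_w)⁻¹`** (locality of `N`, pv09-g4 `extOne` / `ideleEquiv_ideleGalNorm_congr`);
* §5 **`splitEquiv : locTorus K L (inr v) ≃ₜ* (w.adicCompletion L)ˣ`**, `z ↦ z_w`, inverse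
  `y ↦ (y, σ(y)⁻¹)`, and the level: **`mem_inH_iff_of_split`** `g ∈ (Π_{u∣v} 𝒪_uˣ) ⊓ U_v ↔ g_w ∈ 𝒪_wˣ`
  `↔ Valued.v g_w = 1 ↔ ‖g_w‖ = 1` (`map_inH_splitEquiv` : the level maps ONTO `𝒪_wˣ`);
* §6 the CM instance of `h2`; §7 the END binders at a split place for `G_v := locTorus K L v`:
  `τ_v := splitEquiv`, `ord_v := ord_{ϖ_w} ∘ splitEquiv` (`splitOrd`, lineage `IsUniformizer.ord`),
  `ϖ_v := splitEquiv⁻¹ ϖ_w` (`splitUnif`), `ord_v ϖ_v = ofAdd 1` (`splitOrd_splitUnif`),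
  `ord_v g = 1 ↔ g ∈ B_v` (`splitOrd_eq_one_iff`) — the shapes of `RallisAdicEnd` / `SplitShells`
  (`τ`, `ord`, `ϖ`, `ord_ϖ`, `ker_ord`; pv13-g3's `τU_v`, `hτUB : g ∈ B_v ↔ ‖τU_v g‖ = 1`).

This is the group half of PerL v5's dictionary at split places, tex l. 610 "`U(W_i)(L_{0,v})` is compact
unless `v` splits in `L`, where it is `L_{0,v}^×`" (PerL's `L_0` = the base field, our `K`), with the maximal compact
level `U(1)(𝒪_v)` (tex ll. 624, 631), inside the genuine adelic torus.  What is NOT done here: the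
identification of completions `L_w = K_v` at a split place (`e = f = 1`); it is not needed — the END's
local-field slot (`RallisAdicEnd`: `(L₀, w i)`, any finite place of any number field) is served with
`L₀ := L`, `w v := w` — and is recorded as residual (d2′) in GAPS.  PerL is the USE of these statements, not
an input: nothing is cited; every statement is proved from Mathlib and landed package modules.
-/

set_option autoImplicit false

noncomputable section

open Topology Filter Set Sum IsDedekindDomain NumberField
open Literature.NumberTheory Literature.NumberTheory.Automorphic
open scoped RestrictedProduct Classical

namespace HodgeCM.PerL34.IdelicTorusModel

open IdelePlaces RestrictedRegroup RestrictedCutout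

variable (K L : Type) [Field K] [Field L] [Algebra K L] [NumberField K] [NumberField L]

/-! ## §1  Idele coordinates of conjugates and of the Galois norm at the finite places -/

/-- The finite local coordinates of an idele as a TOTAL dependent family `u ↦ y_u ∈ L_u`
(so that transport along equalities of places is available). -/
def fc (y : ideleGroup L) (u : HeightOneSpectrum (𝓞 L)) : u.adicCompletion L :=
  ((ideleEquiv L y (inr u) : (u.adicCompletion L)ˣ) : u.adicCompletion L)

omit [NumberField K] in
/-- (Ported verbatim from the HodgeCMPerL package; no docstring in the source.) -/
theorem fc_def (y : ideleGroup L) (u : HeightOneSpectrum (𝓞 L)) :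
    fc L y u = ((ideleEquiv L y (inr u) : (u.adicCompletion L)ˣ) : u.adicCompletion L) := rfl

omit [NumberField K] in
/-- (Ported verbatim from the HodgeCMPerL package; no docstring in the source.) -/
@[simp] theorem fc_one (u : HeightOneSpectrum (𝓞 L)) : fc L 1 u = 1 := by
  simp [fc_def]

omit [NumberField K] in
/-- (Ported verbatim from the HodgeCMPerL package; no docstring in the source.) -/
theorem fc_mul (y y' : ideleGroup L) (u : HeightOneSpectrum (𝓞 L)) : fc L (y * y') u = fc L y u * fc L y' u := by
  simp [fc_def]

omit [NumberField K] in
/-- **`(σ • y)_u = σ_u (y_{σ⁻¹ u})`** (vendored `FiniteAdeleRing.smul_apply`, definitional). -/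
theorem fc_galSmul (σ : L ≃ₐ[K] L) (y : ideleGroup L) (u : HeightOneSpectrum (𝓞 L)) :
    fc L (σ • y) u = galAdicCompletionMap σ (smul_inv_smul σ u) (fc L y (σ⁻¹ • u)) := rfl

omit [NumberField K] in
/-- **`(N y)_u = ∏_σ σ_u (y_{σ⁻¹ u})`** for pv11-g4's Galois norm `N y = ∏_σ σ • y`. -/
theorem fc_ideleGalNorm [FiniteDimensional K L] (y : ideleGroup L) (u : HeightOneSpectrum (𝓞 L)) :
    fc L (AdeleRing.ideleGalNorm K L y) u =
      ∏ σ : L ≃ₐ[K] L, galAdicCompletionMap σ (smul_inv_smul σ u) (fc L y (σ⁻¹ • u)) := by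
  rw [fc_def, AdeleRing.ideleGalNorm_apply, map_prod, ← RestrictedProduct.evalMonoidHom_apply (LocUnits L), map_prod]
  change ((∏ σ : L ≃ₐ[K] L, (ideleEquiv L (σ • y)) (inr u) : (u.adicCompletion L)ˣ) : u.adicCompletion L) = _
  rw [Units.coe_prod]
  exact Finset.prod_congr rfl fun σ _ => fc_galSmul K L σ y u

/-! ## §2  Quadratic Galois set-up: `Aut(L/K) = {1, σ}` -/

section quadratic

variable {K L}
variable (σ : L ≃ₐ[K] L) (h2 : ∀ τ : L ≃ₐ[K] L, τ = 1 ∨ τ = σ)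
include h2

omit [NumberField K] [NumberField L] in
/-- (Ported verbatim from the HodgeCMPerL package; no docstring in the source.) -/
theorem mul_self_of_pair : σ * σ = 1 := by
  rcases h2 (σ * σ) with h | h
  · exact h
  · have h1 : σ = 1 := mul_left_cancel (a := σ) (by rw [h, mul_one])
    rw [h1, mul_one]

omit [NumberField K] [NumberField L] in
/-- (Ported verbatim from the HodgeCMPerL package; no docstring in the source.) -/
theorem inv_of_pair : σ⁻¹ = σ := inv_eq_of_mul_eq_one_right (mul_self_of_pair σ h2)

omit [NumberField K] [NumberField L] in
/-- (Ported verbatim from the HodgeCMPerL package; no docstring in the source.) -/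
theorem smul_smul_of_pair (u : HeightOneSpectrum (𝓞 L)) : σ • σ • u = u := by
  rw [smul_smul, mul_self_of_pair σ h2, one_smul]

omit [NumberField K] [NumberField L] in
/-- (Ported verbatim from the HodgeCMPerL package; no docstring in the source.) -/
theorem inv_smul_of_pair (u : HeightOneSpectrum (𝓞 L)) : σ⁻¹ • u = σ • u := by
  rw [inv_of_pair σ h2]

omit [NumberField K] [NumberField L] in
/-- (Ported verbatim from the HodgeCMPerL package; no docstring in the source.) -/
theorem univ_of_pair [FiniteDimensional K L] : (Finset.univ : Finset (L ≃ₐ[K] L)) = {1, σ} := by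
  ext τ
  simp only [Finset.mem_univ, Finset.mem_insert, Finset.mem_singleton, true_iff]
  exact h2 τ

omit [NumberField K] in
/-- `σ ∘ σ = id` on completions: `σ_{σu} (σ_u x) = x`. -/
theorem galAdicCompletionMap_galAdicCompletionMap_of_pair {u u' : HeightOneSpectrum (𝓞 L)} (h : σ • u = u')
    (h' : σ • u' = u) (x : u.adicCompletion L) :
    galAdicCompletionMap σ h' (galAdicCompletionMap σ h x) = x := by
  rw [galAdicCompletionMap_galAdicCompletionMap,
    galAdicCompletionMap_congr_left L (mul_self_of_pair σ h2) _ (one_smul _ u), galAdicCompletionMap_one]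

omit [NumberField K] in
/-- **The Galois norm of a quadratic extension on coordinates: `(N y)_u = y_u · σ(y_{σu})`.** -/
theorem fc_ideleGalNorm_of_pair [FiniteDimensional K L] (hσ : σ ≠ 1) (y : ideleGroup L) (u : HeightOneSpectrum (𝓞 L)) :
    fc L (AdeleRing.ideleGalNorm K L y) u =
      fc L y u * galAdicCompletionMap σ (smul_smul_of_pair σ h2 u) (fc L y (σ • u)) := by
  rw [fc_ideleGalNorm, univ_of_pair σ h2, Finset.prod_pair hσ.symm]
  have h1 : (1 : L ≃ₐ[K] L)⁻¹ • u = u := by rw [inv_one, one_smul]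
  congr 1
  · rw [galAdicCompletionMap_apply_congr_place L h1 (smul_inv_smul 1 u) (one_smul _ u) (fc L y),
      galAdicCompletionMap_one]
  · exact galAdicCompletionMap_apply_congr_place L (inv_smul_of_pair σ h2 u) _ _ (fc L y)

end quadratic

section split

variable {K L}

/-! ## §3  Local units: integrality as `Valued.v = 1` / `‖·‖ = 1`, and Galois transport of units -/

omit [NumberField K] in
/-- `x ∈ 𝒪_uˣ` (pv09-g4's integral level `intUnits L (inr u)`) iff `Valued.v x = 1`. -/
theorem mem_intUnits_inr_iff_valued_eq_one (u : HeightOneSpectrum (𝓞 L)) (x : (u.adicCompletion L)ˣ) :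
    x ∈ intUnits L (inr u) ↔ Valued.v (x : u.adicCompletion L) = 1 := by
  rw [intUnits_inr, Submonoid.mem_units_iff]
  change (x : u.adicCompletion L) ∈ u.adicCompletionIntegers L ∧
      ((x⁻¹ : (u.adicCompletion L)ˣ) : u.adicCompletion L) ∈ u.adicCompletionIntegers L ↔ _
  rw [HeightOneSpectrum.mem_adicCompletionIntegers, HeightOneSpectrum.mem_adicCompletionIntegers,
    Units.val_inv_eq_inv_val, map_inv₀]
  have h0 : Valued.v (x : u.adicCompletion L) ≠ 0 := (Valuation.ne_zero_iff _).2 x.ne_zero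
  constructor
  · rintro ⟨h1, h2⟩
    exact le_antisymm h1 ((inv_le_one₀ (zero_lt_iff.2 h0)).1 h2)
  · intro h
    rw [h, inv_one]
    exact ⟨le_rfl, le_rfl⟩

omit [NumberField K] in
/-- `x ∈ 𝒪_uˣ` iff `‖x‖ = 1` (the adic norm, Mathlib `instNormedFieldValuedAdicCompletion`). -/
theorem mem_intUnits_inr_iff_norm_eq_one (u : HeightOneSpectrum (𝓞 L)) (x : (u.adicCompletion L)ˣ) :
    x ∈ intUnits L (inr u) ↔ ‖(x : u.adicCompletion L)‖ = 1 := by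
  rw [mem_intUnits_inr_iff_valued_eq_one, le_antisymm_iff, le_antisymm_iff,
    Valued.toNormedField.norm_le_one_iff, Valued.toNormedField.one_le_norm_iff]

omit [NumberField K] in
/-- The vendored units transport `σ : L_uˣ ≃* L_{σu}ˣ` on values. -/
theorem coe_galAdicCompletionUnitsEquiv (σ : L ≃ₐ[K] L) {u u' : HeightOneSpectrum (𝓞 L)} (h : σ • u = u')
    (x : (u.adicCompletion L)ˣ) :
    ((galAdicCompletionUnitsEquiv σ h x : (u'.adicCompletion L)ˣ) : u'.adicCompletion L) =
      galAdicCompletionMap σ h (x : u.adicCompletion L) := rfl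

omit [NumberField K] in
/-- (Ported verbatim from the HodgeCMPerL package; no docstring in the source.) -/
theorem continuous_galAdicCompletionUnitsEquiv (σ : L ≃ₐ[K] L) {u u' : HeightOneSpectrum (𝓞 L)}
    (h : σ • u = u') : Continuous (galAdicCompletionUnitsEquiv (L := L) σ h) :=
  Continuous.units_map (galAdicCompletionEquiv (L := L) σ h).toMulEquiv.toMonoidHom
    (continuous_galAdicCompletionMap L σ h)

omit [NumberField K] in
/-- `σ 𝒪_uˣ = 𝒪_{σu}ˣ`. -/
theorem galAdicCompletionUnitsEquiv_mem_intUnits_iff (σ : L ≃ₐ[K] L) {u u' : HeightOneSpectrum (𝓞 L)}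
    (h : σ • u = u') (x : (u.adicCompletion L)ˣ) :
    galAdicCompletionUnitsEquiv σ h x ∈ intUnits L (inr u') ↔ x ∈ intUnits L (inr u) := by
  rw [mem_intUnits_inr_iff_valued_eq_one, mem_intUnits_inr_iff_valued_eq_one, coe_galAdicCompletionUnitsEquiv,
    valued_galAdicCompletionMap]

/-! ## §4  The fibre of `pl K L` over a split place and the membership criterion -/

variable (σ : L ≃ₐ[K] L) {w : HeightOneSpectrum (𝓞 L)} {v : HeightOneSpectrum (𝓞 K)} (hwv : w.under (𝓞 K) = v)

/-- `w` as a point of the fibre of `pl K L` over `v = w ∩ K`. -/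
abbrev fibW : Fib (pl K L) (inr v) := ⟨inr w, by rw [pl_inr, hwv]⟩

/-- `σ w` as a point of the fibre of `pl K L` over `v = w ∩ K`. -/
abbrev fibSW : Fib (pl K L) (inr v) := ⟨inr (σ • w), by rw [pl_smul_inr, pl_inr, hwv]⟩

/-- (Ported verbatim from the HodgeCMPerL package; no docstring in the source.) -/
theorem fibW_ne_fibSW (hw : σ • w ≠ w) : fibW hwv ≠ fibSW σ hwv := fun h =>
  hw (Sum.inr_injective (congrArg Subtype.val h)).symm

omit [NumberField K] [NumberField L] in
/-- (Ported verbatim from the HodgeCMPerL package; no docstring in the source.) -/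
theorem ne_one_of_smul_ne (hw : σ • w ≠ w) : σ ≠ 1 := fun h => hw (by rw [h, one_smul])

/-- **The fibre over `v` is `{w, σ w}`** when `Aut(L/K) = {1, σ}` (transitivity on the places over `v`,
vendored `HeightOneSpectrum.exists_algEquiv_smul_eq`). -/
theorem fib_cases [IsGalois K L] (h2 : ∀ τ : L ≃ₐ[K] L, τ = 1 ∨ τ = σ) (i : Fib (pl K L) (inr v)) :
    i = fibW hwv ∨ i = fibSW σ hwv := by
  obtain ⟨j, hj⟩ := i
  cases j with
  | inl x => exact absurd hj (by rw [pl_inl]; exact Sum.inl_ne_inr)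
  | inr u =>
    have hu : w.under (𝓞 K) = u.under (𝓞 K) := by
      rw [pl_inr] at hj
      exact hwv.trans (Sum.inr_injective hj).symm
    obtain ⟨τ, hτ⟩ := HeightOneSpectrum.exists_algEquiv_smul_eq K hu
    rcases h2 τ with rfl | rfl
    · rw [one_smul] at hτ
      subst hτ
      exact Or.inl rfl
    · subst hτ
      exact Or.inr rfl

variable [FiniteDimensional K L]

omit [FiniteDimensional K L] in
/-- The `w`-coordinate of the extension by one of a `v`-block. -/
theorem fc_extOne_w (z : FibGroup K L (inr v)) :
    fc L (extOne K L (inr v) z) w = ((z (fibW hwv) : (w.adicCompletion L)ˣ) : w.adicCompletion L) := by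
  change ((proj K L (inr v) (extOne K L (inr v) z) (fibW hwv) : (w.adicCompletion L)ˣ) : w.adicCompletion L) = _
  rw [proj_extOne_same]

omit [FiniteDimensional K L] in
/-- The `σw`-coordinate of the extension by one of a `v`-block. -/
theorem fc_extOne_sw (z : FibGroup K L (inr v)) :
    fc L (extOne K L (inr v) z) (σ • w) =
      ((z (fibSW σ hwv) : ((σ • w).adicCompletion L)ˣ) : (σ • w).adicCompletion L) := by
  change ((proj K L (inr v) (extOne K L (inr v) z) (fibSW σ hwv) : ((σ • w).adicCompletion L)ˣ) :
    (σ • w).adicCompletion L) = _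
  rw [proj_extOne_same]

variable (K L) in
omit [FiniteDimensional K L] in
/-- Off the fibre, the extension by one is `1`. -/
theorem ideleEquiv_extOne_of_ne (k : Place K) (z : FibGroup K L k) {i : Place L} (hi : pl K L i ≠ k) :
    ideleEquiv L (extOne K L k z) i = 1 := by
  change proj K L (pl K L i) (extOne K L k z) ⟨i, rfl⟩ = 1
  rw [proj_extOne_of_ne K L hi]
  rfl

omit [NumberField K] [FiniteDimensional K L] in
/-- From `z_{σw} · σ(z_w) = 1` to `z_w · σ(z_{σw}) = 1` (apply `σ : L_{σw} → L_w`, `σ² = 1`). -/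
theorem splitRel_symm (h2 : ∀ τ : L ≃ₐ[K] L, τ = 1 ∨ τ = σ) (hsw : σ • σ • w = w)
    {a : (w.adicCompletion L)} {b : (σ • w).adicCompletion L}
    (h : b * galAdicCompletionMap σ rfl a = 1) : a * galAdicCompletionMap σ hsw b = 1 := by
  have := congrArg (galAdicCompletionMap (L := L) σ hsw) h
  rwa [map_mul, map_one, galAdicCompletionMap_galAdicCompletionMap_of_pair σ h2 rfl hsw, mul_comm] at this

/-- **Membership in the local group at a split place**: `z ∈ U_v ↔ z_{σw} = σ(z_w)⁻¹`. -/
theorem mem_locTorus_iff_of_split [IsGalois K L] (h2 : ∀ τ : L ≃ₐ[K] L, τ = 1 ∨ τ = σ) (hw : σ • w ≠ w)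
    (z : FibGroup K L (inr v)) :
    z ∈ locTorus K L (inr v) ↔ z (fibSW σ hwv) = (galAdicCompletionUnitsEquiv σ rfl (z (fibW hwv)))⁻¹ := by
  have hσ : σ ≠ 1 := ne_one_of_smul_ne σ hw
  have hsw : σ • σ • w = w := smul_smul_of_pair σ h2 w
  rw [eq_inv_iff_mul_eq_one, ← Units.val_eq_one, Units.val_mul, coe_galAdicCompletionUnitsEquiv,
    mem_locTorus_iff_extOne_mem, mem_relNormOneIdeles_iff]
  constructor
  · intro hN
    have h1 : fc L (AdeleRing.ideleGalNorm K L (extOne K L (inr v) z)) (σ • w) = 1 := by rw [hN, fc_one]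
    rwa [fc_ideleGalNorm_of_pair σ h2 hσ, galAdicCompletionMap_apply_congr_place L hsw _ rfl (fc L _),
      fc_extOne_w hwv, fc_extOne_sw σ hwv] at h1
  · intro hrel'
    have hrel := splitRel_symm σ h2 hsw hrel'
    apply (ideleEquiv L).injective
    rw [map_one]
    ext1 i
    by_cases hi : pl K L i = inr v
    · rcases fib_cases σ hwv h2 ⟨i, hi⟩ with h | h
      · have hi' : i = inr w := congrArg Subtype.val h
        subst hi'
        apply Units.ext
        change fc L (AdeleRing.ideleGalNorm K L (extOne K L (inr v) z)) w = 1
        rw [fc_ideleGalNorm_of_pair σ h2 hσ, fc_extOne_w hwv, fc_extOne_sw σ hwv]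
        exact hrel
      · have hi' : i = inr (σ • w) := congrArg Subtype.val h
        subst hi'
        apply Units.ext
        change fc L (AdeleRing.ideleGalNorm K L (extOne K L (inr v) z)) (σ • w) = 1
        rw [fc_ideleGalNorm_of_pair σ h2 hσ, galAdicCompletionMap_apply_congr_place L hsw _ rfl (fc L _),
          fc_extOne_w hwv, fc_extOne_sw σ hwv]
        exact hrel'
    · have hloc : ∀ j, pl K L j = pl K L i →
          ideleEquiv L (extOne K L (inr v) z) j = ideleEquiv L (1 : ideleGroup L) j := by
        intro j hj
        rw [map_one, ideleEquiv_extOne_of_ne K L (inr v) z (hj ▸ hi :  pl K L j ≠ inr v)]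
        rfl
      rw [ideleEquiv_ideleGalNorm_congr K L hloc, map_one, map_one]

/-- At a split place, `z ∈ U_v` satisfies `z_w · σ(z_{σw}) = 1` … -/
theorem coe_mul_gal_coe_eq_one_of_mem [IsGalois K L] (h2 : ∀ τ : L ≃ₐ[K] L, τ = 1 ∨ τ = σ) (hw : σ • w ≠ w)
    (hsw : σ • σ • w = w) {z : FibGroup K L (inr v)} (hz : z ∈ locTorus K L (inr v)) :
    ((z (fibW hwv) : (w.adicCompletion L)ˣ) : w.adicCompletion L) *
      galAdicCompletionMap σ hsw ((z (fibSW σ hwv) : ((σ • w).adicCompletion L)ˣ) : (σ • w).adicCompletion L) = 1 := by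
  apply splitRel_symm σ h2 hsw
  have h := (mem_locTorus_iff_of_split σ hwv h2 hw z).1 hz
  rw [eq_inv_iff_mul_eq_one, ← Units.val_eq_one, Units.val_mul, coe_galAdicCompletionUnitsEquiv] at h
  exact h

/-! ## §5  The identification `U_v ≃ₜ* L_wˣ` and its level -/

/-- The inverse map `y ↦ (y, σ(y)⁻¹) ∈ Π_{u ∣ v} L_uˣ`. -/
def splitLift (y : (w.adicCompletion L)ˣ) : FibGroup K L (inr v) :=
  Pi.mulSingle (fibW hwv) y * Pi.mulSingle (fibSW σ hwv) (galAdicCompletionUnitsEquiv σ rfl y)⁻¹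

omit [FiniteDimensional K L] in
/-- (Ported verbatim from the HodgeCMPerL package; no docstring in the source.) -/
theorem splitLift_apply_w (hw : σ • w ≠ w) (y : (w.adicCompletion L)ˣ) : splitLift σ hwv y (fibW hwv) = y := by
  rw [splitLift]
  rw [Pi.mul_apply]
  rw [Pi.mulSingle_eq_same]
  rw [Pi.mulSingle_eq_of_ne (fibW_ne_fibSW σ hwv hw)]
  rw [mul_one]

omit [FiniteDimensional K L] in
/-- (Ported verbatim from the HodgeCMPerL package; no docstring in the source.) -/
theorem splitLift_apply_sw (hw : σ • w ≠ w) (y : (w.adicCompletion L)ˣ) :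
    splitLift σ hwv y (fibSW σ hwv) = (galAdicCompletionUnitsEquiv σ rfl y)⁻¹ := by
  rw [splitLift, Pi.mul_apply, Pi.mulSingle_eq_same, Pi.mulSingle_eq_of_ne (fibW_ne_fibSW σ hwv hw).symm,
    one_mul]

omit [FiniteDimensional K L] in
/-- (Ported verbatim from the HodgeCMPerL package; no docstring in the source.) -/
theorem continuous_splitLift : Continuous (splitLift (L := L) σ hwv) := by
  change Continuous fun y : (w.adicCompletion L)ˣ =>
    (Pi.mulSingle (fibW hwv) y : FibGroup K L (inr v)) *
      Pi.mulSingle (fibSW σ hwv) (galAdicCompletionUnitsEquiv σ rfl y)⁻¹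
  refine Continuous.mul ?_ ?_
  · exact continuous_mulSingle (A := fun j : Fib (pl K L) (inr v) => LocUnits L j.1) (fibW hwv)
  · exact (continuous_mulSingle (A := fun j : Fib (pl K L) (inr v) => LocUnits L j.1) (fibSW σ hwv)).comp
      (continuous_galAdicCompletionUnitsEquiv σ rfl).inv

/-- (Ported verbatim from the HodgeCMPerL package; no docstring in the source.) -/
theorem splitLift_mem [IsGalois K L] (h2 : ∀ τ : L ≃ₐ[K] L, τ = 1 ∨ τ = σ) (hw : σ • w ≠ w)
    (y : (w.adicCompletion L)ˣ) : splitLift σ hwv y ∈ locTorus K L (inr v) := by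
  rw [mem_locTorus_iff_of_split σ hwv h2 hw, splitLift_apply_sw σ hwv hw, splitLift_apply_w σ hwv hw]

/-- **`U_v ≃ₜ* L_wˣ` at a split place** (`z ↦ z_w`; inverse `y ↦ (y, σ(y)⁻¹)`).  This is the group half of
PerL v5's split-place dictionary "`U(W_i)(L_{0,v})` … is `L_{0,v}^×`" (tex l. 610) for the genuine model; the END's
local-field slot at `v` (`RallisAdicEnd`: `τ v : G v ≃ₜ* F_vˣ`, `F_v` any nonarchimedean local field of
characteristic zero) is served with `F_v := L_w` — the further identification `L_w = K_v` (`e = f = 1` at a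
split place) is true but not needed and not claimed here. -/
def splitEquiv [IsGalois K L] (h2 : ∀ τ : L ≃ₐ[K] L, τ = 1 ∨ τ = σ) (hw : σ • w ≠ w) :
    locTorus K L (inr v) ≃ₜ* (w.adicCompletion L)ˣ where
  toFun g := (g : FibGroup K L (inr v)) (fibW hwv)
  invFun y := ⟨splitLift σ hwv y, splitLift_mem σ hwv h2 hw y⟩
  left_inv g := by
    apply Subtype.ext
    funext i
    change splitLift σ hwv ((g : FibGroup K L (inr v)) (fibW hwv)) i = (g : FibGroup K L (inr v)) i
    rcases fib_cases σ hwv h2 i with rfl | rfl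
    · exact splitLift_apply_w σ hwv hw _
    · rw [splitLift_apply_sw σ hwv hw]
      exact ((mem_locTorus_iff_of_split σ hwv h2 hw _).1 g.2).symm
  right_inv y := splitLift_apply_w σ hwv hw y
  map_mul' _ _ := rfl
  continuous_toFun := (continuous_apply (fibW hwv)).comp continuous_subtype_val
  continuous_invFun := (continuous_splitLift σ hwv).subtype_mk _


-- port_pkg: scope closed for this part
end split
end HodgeCM.PerL34.IdelicTorusModel
end
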